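import Mathlib
import HarnessLib
import Summits.HubbardSuperconductivity.HubbardSuperconductivity.Theorems.KLProgrammeKLRegimeWickCrossContractionGramValue
import Summits.HubbardSuperconductivity.HubbardSuperconductivity.Theorems.KLProgrammeKLRegimeWickCrossContractionSector

/-!
# Route `KLProgramme` — ENGINE child gen 6 (stmt-HubbardSuperconductivity-20236 `KLRegimeEngineV16`), `stub_engine_step_values` (E2-v10):
# the value form with a Gram tail, ROLES EXCHANGED — `a` anchored through the slice line, `b` through its free legs
# (cell gate-hubbard-kl, seat p5 g5; companion of `…WickCrossContractionGramValue`, p518743)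

`…GramValue.norm_kernel_crossContract_value_sectorPreimage_le_gram` needs at least one output leg from `a` (`m₀ + 1`): `a` is anchored at its free legs.
For the colourings in which every output leg comes from `b` (e.g. `𝒲₄` fully contracted against `𝒲₈` carrying the four pair labels — the `(4,8)` class
of HOME/prover-p5/E5-GAIN-SCALE-N.md §1) the roles are exchanged, exactly as in p5 g4's `…_value_le_of_b`:

* **`norm_kernel_crossContract_value_le_gram_of_b`** — generic lines: `a` with its line-`0` leg fixed, the sectors of its explicit legs `1 … e'`
  fixed, its Gram legs summed and its free legs fixed (`Na`, level `e' + 1 + m₀`); `b` with its free legs fixed and all its contracted legs summed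
  (`Nb`); line `0` by the row sums of its two-point function (= column sums);
* **`norm_kernel_crossContract_value_pullback_le_gram_of_b`** — lines `S(F)ᵀ·C_p·S(F)`;
* **`norm_kernel_crossContract_value_sectorPreimage_le_gram_of_b`** — engine currency: `Ga` at level `e' + 1 + m₀`, `Gb` at level `m₁ + 1`;
* **`…_klAniso_le_gram_of_b`** — on `klAnisoFamily … n` (`36·δ_i`).

Pure bookkeeping; no definitions, no named facts.
-/

noncomputable section

namespace Summit.HubbardSuperconductivity.HubbardSuperconductivity.Theorems.KLRegimeWick

set_option linter.dupNamespace false -- summit = problem name (single-conjunct summit), D-0017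

open Literature.MathematicalPhysics.QuantumLattice Literature.Probability.LatticeModels GrassmannAlgebra Finset Matrix
open Summit.HubbardSuperconductivity.HubbardSuperconductivity.Theorems.KLRegimeSplit
open scoped InnerProductSpace

/-! ## §1 Generic lines -/

section Value

variable {𝕜 : Type*} [RCLike 𝕜] {E : Type*} [NormedAddCommGroup E] [InnerProductSpace 𝕜 E]
variable {P S : Type*} [Fintype P] [Fintype S] [DecidableEq P] [DecidableEq S] {ι : Type*} [Fintype ι] [DecidableEq ι]

/-- **Value form with a Gram tail, roles exchanged**: `‖kernel (…) m (Z,s)‖ ≤ ((k+m₀)!(k+m₁)!/(m!·(k−e'−1)!))·(Σκ²)^{k−e'−1}·(c·∏_{i<e'}(d_i r_i)·Na·Nb)`,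
`a` anchored at its line-`0` leg (explicit sectors fixed, Gram legs summed, free legs fixed), `b` at its free legs (contracted legs summed).
[cite: FeldmanKnorrerTrubowitz2004, App. B] -/
theorem norm_kernel_crossContract_value_le_gram_of_b (q : P × S → Bool) (Cg : ι → Matrix (P × S) (P × S) 𝕜)
    (hCg : ∀ s X Y, q X = q Y → Cg s X Y = 0) (f g : ι → P × S → E) (κ : ι → ℝ)
    (hf : ∀ s X, q X = true → ‖f s X‖ ≤ κ s) (hg : ∀ s Y, q Y = false → ‖g s Y‖ ≤ κ s)
    (hG : ∀ s X Y, q X = true → q Y = false → contr 𝕜 (Cg s) X Y = ⟪f s X, g s Y⟫_𝕜)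
    {k e' m m₀ m₁ : ℕ} (he : e' + 1 ≤ k) (C : Fin k → Matrix (P × S) (P × S) 𝕜) (τ : Fin k → ι)
    (hCτ : ∀ i : Fin k, e' + 1 ≤ (i : ℕ) → C i = Cg (τ i))
    (a b : GrassmannAlgebra 𝕜 (P × S)) (s : Fin m → Fin 2) (hm₀ : (univ.filter fun i => s i = 0).card = m₀)
    (hm₁ : (univ.filter fun i => s i = 1).card = m₁) (Z : Fin m → P × S)
    {c : ℝ} (hc0 : 0 ≤ c) (hc : ∀ X, ∑ Y, ‖contr 𝕜 (C (Fin.castLE he 0)) X Y‖ ≤ c)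
    (D : Fin e' → S → S → ℝ) (hD : ∀ i σ τ, 0 ≤ D i σ τ) (d r : Fin e' → ℝ) (hd : ∀ i, 0 ≤ d i) (hr0 : ∀ i, 0 ≤ r i)
    (hLD : ∀ (i : Fin e') (X Y : P × S), ‖contr 𝕜 (C (Fin.castLE he i.succ)) X Y‖ ≤ d i * D i X.2 Y.2) (hr : ∀ i τ, ∑ σ, D i σ τ ≤ r i)
    {Na Nb : ℝ} (hNa0 : 0 ≤ Na)
    (hNa : ∀ (X₀ : P × S) (σ' : Fin e' → S) (Z₀ : Fin m₀ → P × S), ∑ x : Fin e' → P,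
      ∑ X ∈ univ.filter (fun X : Fin k → P × S =>
        (fun i => X (Fin.castLE he i)) = (Fin.cons X₀ (fun i => (x i, σ' i)) : Fin (e' + 1) → P × S)),
          ‖kernel 𝕜 a (k + m₀) (Fin.append X Z₀)‖ ≤ Na)
    (hNb : ∀ Y₁ : Fin m₁ → P × S, ∑ Y : Fin k → P × S, ‖kernel 𝕜 b (k + m₁) (Fin.append Y Y₁)‖ ≤ Nb) :
    ‖kernel 𝕜 (((List.ofFn fun i => grassmannLaplacian 𝕜 (crossCov 𝕜 (C i))).reverse).prod
        (dblCopy 𝕜 0 a * dblCopy 𝕜 1 b)) m (fun i => (Z i, s i))‖ ≤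
      (((k + m₀).factorial * (k + m₁).factorial : ℝ) / (m.factorial * (k - (e' + 1)).factorial)) * (∑ s, κ s ^ 2) ^ (k - (e' + 1)) *
        (c * (∏ i, d i * r i) * Na * Nb) := by
  classical
  obtain ⟨h, σ, ε, h0, h1, hZ⟩ := exists_colouring_equiv (Γ := P × S) s hm₀ hm₁
  refine (norm_kernel_crossContract_le_gram_fiber q Cg hCg f g κ hf hg hG he C τ hCτ a b (fun i => (Z i, s i)) h σ
    (fun j => Z (ε (Sum.inl j))) (fun j => Z (ε (Sum.inr j))) (hZ Z)).trans ?_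
  have hK0 : 0 ≤ (∑ s, κ s ^ 2) ^ (k - (e' + 1)) := pow_nonneg (sum_nonneg fun s _ => sq_nonneg (κ s)) _
  refine mul_le_mul_of_nonneg_left ?_ (mul_nonneg (by positivity) hK0)
  have hc' : ∀ Y, ∑ X, ‖contr 𝕜 (C (Fin.castLE he 0)) X Y‖ ≤ c := fun Y => by
    simp_rw [norm_contr_swap (C (Fin.castLE he 0)) Y]; exact hc Y
  have hNb' : ∑ Ye : Fin (e' + 1) → P × S, ∑ Y ∈ univ.filter (fun Y : Fin k → P × S => (fun i => Y (Fin.castLE he i)) = Ye),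
      ‖kernel 𝕜 b (k + m₁) (Fin.append Y fun j => Z (ε (Sum.inr j)))‖ ≤ Nb := by
    rw [sum_fiberwise]
    exact hNb _
  have hmain := sum_crossContraction_value_le_symm
    (fun Xe : Fin (e' + 1) → P × S => ∑ X ∈ univ.filter (fun X : Fin k → P × S => (fun i => X (Fin.castLE he i)) = Xe),
      ‖kernel 𝕜 a (k + m₀) (Fin.append X fun j => Z (ε (Sum.inl j)))‖)
    (fun Ye : Fin (e' + 1) → P × S => ∑ Y ∈ univ.filter (fun Y : Fin k → P × S => (fun i => Y (Fin.castLE he i)) = Ye),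
      ‖kernel 𝕜 b (k + m₁) (Fin.append Y fun j => Z (ε (Sum.inr j)))‖)
    (fun Xe => sum_nonneg fun _ _ => norm_nonneg _) (fun Ye => sum_nonneg fun _ _ => norm_nonneg _)
    (fun i X Y => ‖contr 𝕜 (C (Fin.castLE he i)) X Y‖) (fun i X Y => norm_nonneg _) hc0 hc' D hD d r hd hr0 hLD hr hNa0
    (fun X₀ σ' => hNa X₀ σ' _) hNb'
  refine le_trans (le_of_eq ?_) hmain
  exact sum_congr rfl fun X _ => sum_congr rfl fun Y _ => by ring

end Value

/-! ## §2 Lines `S(F)ᵀ·C_p·S(F)` and engine currency -/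

section Pullback

variable {L M N : ℕ} [NeZero L]

/-- **Value form with a Gram tail for sectorised normal covariances, roles exchanged.** [cite: BenfattoGiulianiMastropietro2006, §2.8 (2.80)] -/
theorem norm_kernel_crossContract_value_pullback_le_gram_of_b {k e' m m₀ m₁ : ℕ} (he : e' + 1 ≤ k) (β : ℝ)
    (F : Fin N → FreqMomentum L M → ℂ)
    {ρ₀ : ℕ} (hρ₀ : ∀ ω : Fin N, ((univ : Finset (Fin N)).filter fun ω' => ∃ q, F ω q * F ω' q ≠ 0).card ≤ ρ₀)
    (sym : Fin k → FreqMomentum L M × Fin 2 → ℂ) (κ : Fin k → ℝ)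
    (hκF : ∀ (i : Fin k) (Y : SpaceTimeIdx L M × SectorLeg N), Y.2.2 = 0 → ‖sectorGramF L M β F (sym i) Y‖ ≤ κ i)
    (hκG : ∀ (i : Fin k) (Y : SpaceTimeIdx L M × SectorLeg N), Y.2.2 = 1 → ‖sectorGramG L M β F (sym i) Y‖ ≤ κ i)
    (a b : GrassmannAlgebra ℂ (SpaceTimeIdx L M × SectorLeg N)) (s : Fin m → Fin 2)
    (hm₀ : (univ.filter fun i => s i = 0).card = m₀) (hm₁ : (univ.filter fun i => s i = 1).card = m₁)
    (Z : Fin m → SpaceTimeIdx L M × SectorLeg N) {α : ℝ} (hα : 0 ≤ α)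
    (hrow : ∀ X, ∑ Y, ‖((sectorSubMatrix L M β F).transpose * normalCovariance L M (sym (Fin.castLE he 0)) * sectorSubMatrix L M β F) X Y‖ ≤ α)
    (hcol : ∀ Y, ∑ X, ‖((sectorSubMatrix L M β F).transpose * normalCovariance L M (sym (Fin.castLE he 0)) * sectorSubMatrix L M β F) X Y‖ ≤ α)
    (δ : Fin e' → ℝ) (hδ : ∀ i, 0 ≤ δ i)
    (hent : ∀ (i : Fin e') X Y,
      ‖((sectorSubMatrix L M β F).transpose * normalCovariance L M (sym (Fin.castLE he i.succ)) * sectorSubMatrix L M β F) X Y‖ ≤ δ i)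
    {Na Nb : ℝ} (hNa0 : 0 ≤ Na)
    (hNa : ∀ (X₀ : SpaceTimeIdx L M × SectorLeg N) (σ' : Fin e' → SectorLeg N) (Z₀ : Fin m₀ → SpaceTimeIdx L M × SectorLeg N),
      ∑ x : Fin e' → SpaceTimeIdx L M, ∑ X ∈ univ.filter (fun X : Fin k → SpaceTimeIdx L M × SectorLeg N =>
        (fun i => X (Fin.castLE he i)) = (Fin.cons X₀ (fun i => (x i, σ' i)) : Fin (e' + 1) → SpaceTimeIdx L M × SectorLeg N)),
          ‖kernel ℂ a (k + m₀) (Fin.append X Z₀)‖ ≤ Na)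
    (hNb : ∀ Y₁ : Fin m₁ → SpaceTimeIdx L M × SectorLeg N, ∑ Y : Fin k → SpaceTimeIdx L M × SectorLeg N,
      ‖kernel ℂ b (k + m₁) (Fin.append Y Y₁)‖ ≤ Nb) :
    ‖kernel ℂ (((List.ofFn fun i => grassmannLaplacian ℂ (crossCov ℂ
        ((sectorSubMatrix L M β F).transpose * normalCovariance L M (sym i) * sectorSubMatrix L M β F))).reverse).prod
        (dblCopy ℂ 0 a * dblCopy ℂ 1 b)) m (fun i => (Z i, s i))‖ ≤
      (((k + m₀).factorial * (k + m₁).factorial : ℝ) / (m.factorial * (k - (e' + 1)).factorial)) * (∑ i, κ i ^ 2) ^ (k - (e' + 1)) *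
        (α * (∏ i, δ i * ((4 * ρ₀ : ℕ) : ℝ)) * Na * Nb) := by
  classical
  refine norm_kernel_crossContract_value_le_gram_of_b (fun Y : SpaceTimeIdx L M × SectorLeg N => decide (Y.2.2 = 0))
    (fun i => (sectorSubMatrix L M β F).transpose * normalCovariance L M (sym i) * sectorSubMatrix L M β F)
    (fun i X Y hq => pullback_normalCovariance_apply_of_charge_eq β F (sym i) (by
      have h' : X.2.2 = 0 ↔ Y.2.2 = 0 := by simpa using hq
      rw [Fin.ext_iff, Fin.ext_iff, Fin.val_zero] at h'
      rw [Fin.ext_iff]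
      have hX2 := X.2.2.isLt
      have hY2 := Y.2.2.isLt
      omega))
    (fun i => sectorGramF L M β F (sym i)) (fun i => sectorGramG L M β F (sym i)) κ
    (fun i X hX => hκF i X (by simpa using hX)) (fun i Y hY => hκG i Y ?_)
    (fun i X Y hX hY => contr_pullback_normalCovariance_eq_inner β F (sym i) (by simpa using hX) ?_)
    he _ id (fun i _ => rfl) a b s hm₀ hm₁ Z hα (sum_norm_contr_le _ hrow hcol)
    (fun _ σ τ => if (∃ q, F σ.1.1 q * F τ.1.1 q ≠ 0) then (1 : ℝ) else 0) (fun _ σ τ => by positivity)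
    δ (fun _ => ((4 * ρ₀ : ℕ) : ℝ)) hδ (fun _ => by positivity)
    (fun i X Y => norm_contr_le_indicator_of_support _ (fun σ τ : SectorLeg N => ∃ q, F σ.1.1 q * F τ.1.1 q ≠ 0)
      (fun σ τ ⟨q, hq⟩ => ⟨q, by rwa [mul_comm] at hq⟩) (hδ i) (hent i)
      (fun X Y hXY => exists_mul_ne_zero_of_pullback_normalCovariance_ne_zero β F (sym _) hXY) X Y)
    (fun _ τ => sum_indicator_le_of_card_le' (fun σ τ : SectorLeg N => ∃ q, F σ.1.1 q * F τ.1.1 q ≠ 0)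
      (fun σ τ ⟨q, hq⟩ => ⟨q, by rwa [mul_comm] at hq⟩) (fun σ' => ?_) τ) hNa0 hNa hNb
  · have h2 : (Y.2.2 : Fin 2) ≠ 0 := by simpa using hY
    omega
  · have h2 : (Y.2.2 : Fin 2) ≠ 0 := by simpa using hY
    omega
  · exact (card_filter_sectorLeg_le fun ω' => ∃ q, F σ'.1.1 q * F ω' q ≠ 0).trans (Nat.mul_le_mul_left 4 (hρ₀ σ'.1.1))

/-- **Value form with a Gram tail between two sector preimages, roles exchanged, in engine currency**: `Ga` at level `e' + 1 + m₀` (its line-`0`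
leg, explicit legs and free legs prescribed, Gram legs free), `Gb` at level `m₁ + 1` (its free legs prescribed).
[cite: BenfattoGiulianiMastropietro2006, §2.8 (2.80)] -/
theorem norm_kernel_crossContract_value_sectorPreimage_le_gram_of_b {k e' m m₀ m₁ : ℕ} (he : e' + 1 ≤ k) {β : ℝ} (hβ : 0 ≤ β)
    (F : Fin N → FreqMomentum L M → ℂ)
    {ρ₀ : ℕ} (hρ₀ : ∀ ω : Fin N, ((univ : Finset (Fin N)).filter fun ω' => ∃ q, F ω q * F ω' q ≠ 0).card ≤ ρ₀)
    (sym : Fin k → FreqMomentum L M × Fin 2 → ℂ) (κ : Fin k → ℝ)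
    (hκF : ∀ (i : Fin k) (Y : SpaceTimeIdx L M × SectorLeg N), Y.2.2 = 0 → ‖sectorGramF L M β F (sym i) Y‖ ≤ κ i)
    (hκG : ∀ (i : Fin k) (Y : SpaceTimeIdx L M × SectorLeg N), Y.2.2 = 1 → ‖sectorGramG L M β F (sym i) Y‖ ≤ κ i)
    (Ga Gb : HubbardGrassmann L M) (s : Fin m → Fin 2)
    (hm₀ : (univ.filter fun i => s i = 0).card = m₀) (hm₁ : (univ.filter fun i => s i = 1).card = m₁ + 1)
    (Z : Fin m → SpaceTimeIdx L M × SectorLeg N) {α : ℝ} (hα : 0 ≤ α)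
    (hrow : ∀ X, ∑ Y, ‖((sectorSubMatrix L M β F).transpose * normalCovariance L M (sym (Fin.castLE he 0)) * sectorSubMatrix L M β F) X Y‖ ≤ α)
    (hcol : ∀ Y, ∑ X, ‖((sectorSubMatrix L M β F).transpose * normalCovariance L M (sym (Fin.castLE he 0)) * sectorSubMatrix L M β F) X Y‖ ≤ α)
    (δ : Fin e' → ℝ) (hδ : ∀ i, 0 ≤ δ i)
    (hent : ∀ (i : Fin e') X Y,
      ‖((sectorSubMatrix L M β F).transpose * normalCovariance L M (sym (Fin.castLE he i.succ)) * sectorSubMatrix L M β F) X Y‖ ≤ δ i)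
    {Na Nb : ℝ} (hNa0 : 0 ≤ Na)
    (hNa : ∀ (ω₀ : SectorLeg N) (σ' : Fin e' → SectorLeg N) (ω₁ : Fin m₀ → SectorLeg N),
      hubbardSectorKernelNorm L M β F (prescribedTuples univ
        (Fin.append (fun i : Fin k => if h : (i : ℕ) < e' + 1 then some ((Fin.cons ω₀ σ' : Fin (e' + 1) → SectorLeg N) ⟨i, h⟩) else none)
          (fun j => some (ω₁ j)))) Ga ≤ Na)
    (hNb : ∀ σ₁ : Fin (m₁ + 1) → SectorLeg N, hubbardSectorKernelNorm L M β F (prescribedTuples univ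
      (Fin.append (fun _ : Fin k => (none : Option (SectorLeg N))) (fun j => some (σ₁ j)))) Gb ≤ Nb) :
    ‖kernel ℂ (((List.ofFn fun i => grassmannLaplacian ℂ (crossCov ℂ
        ((sectorSubMatrix L M β F).transpose * normalCovariance L M (sym i) * sectorSubMatrix L M β F))).reverse).prod
        (dblCopy ℂ 0 (sectorPreimage β F Ga) * dblCopy ℂ 1 (sectorPreimage β F Gb))) m (fun i => (Z i, s i))‖ ≤
      (((k + m₀).factorial * (k + (m₁ + 1)).factorial : ℝ) / (m.factorial * (k - (e' + 1)).factorial)) *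
        (∑ i, κ i ^ 2) ^ (k - (e' + 1)) *
        (α * (∏ i, δ i * ((4 * ρ₀ : ℕ) : ℝ)) * (imagTimeWeight β M * Na) * (imagTimeWeight β M * Nb)) :=
  norm_kernel_crossContract_value_pullback_le_gram_of_b he β F hρ₀ sym κ hκF hκG (sectorPreimage β F Ga) (sectorPreimage β F Gb) s hm₀ hm₁ Z
    hα hrow hcol δ hδ hent (mul_nonneg (imagTimeWeight_nonneg hβ M) hNa0)
    (fun X₀ σ' Z₀ => (sum_sum_filter_castLE_norm_kernel_sectorPreimage_le hβ F Ga he X₀ σ' Z₀).trans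
      (mul_le_mul_of_nonneg_left (hNa _ _ _) (imagTimeWeight_nonneg hβ M)))
    fun Y₁ => (sum_fixed_norm_kernel_sectorPreimage_le hβ F Gb Y₁).trans
      (mul_le_mul_of_nonneg_left (hNb _) (imagTimeWeight_nonneg hβ M))

end Pullback

end Summit.HubbardSuperconductivity.HubbardSuperconductivity.Theorems.KLRegimeWick

end
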